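import Summits.ResolutionOfSingularities.ResolutionOfSingularities.Theses.DefectlessFrames
import Literature.Barriers.ResolutionOfSingularities.InseparableBaseChange

/-!
# Crux `ResidueTranscendenceReduction` (stmt-ResolutionOfSingularities-18875) — negative lemma: no perfect rebasing at a rank-one place

Route `ResolutionOfSingularities/DefectlessFrames`, crux `ResidueTranscendenceReduction := ∀ p prime,
HypA p → ConcB p` (relative local uniformization at RANK-ONE ZERO-DIMENSIONAL valuation rings over PERFECT
fields ⟹ at ALL valuation rings over perfect fields).  Its open content is the DIMENSION HALF: rank-one
valuation rings `O` whose residue field is transcendental over `k`.  Zariski's reduction (1940, C.IV §9)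
adjoins lifts `ξ` of a residue transcendence basis to the ground field, `k' = k(ξ) ⊆ O`, over which `O` is
zero-dimensional — but `k(ξ)` is imperfect, so `HypA` does not apply to `(k', K, O)`.

`not_perfectRebase_rankOne` (cdisprove seat, cycle 1) shows that at a RANK-ONE (even discrete) place no
intermediate ground field whatsoever repairs this: the strengthening

  `∀ p prime, ∀ k perfect of char p, ∀ K/k f.g., ∀ O ⊇ k RANK ONE, ∃ k' intermediate, k' ⊆ O ∧ k' perfect ∧
   O zero-dimensional over k'`

is FALSE.  Witness: `k = 𝔽₂`, `K = 𝔽₂(s)(t)`, `O` = the `t`-adic valuation ring of `K = F(t)`,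
`F = 𝔽₂(s)` (discrete of rank one, residue field `F` transcendental over `k`).  Mechanism
(`exists_pow_sub_mem_nonunits_of_perfect`, general): if `x ∈ O` has residue algebraic over the residue image
`L` of a perfect subfield `k' ⊆ O`, then `L(x̄)` is perfect (`Algebra.IsAlgebraic.perfectField`), so `x̄` is
a `p`-th power in the residue field, i.e. `v(Y^p − x) > 0` for some `Y ∈ O`; for `x = s` this forces
(`exists_pow_eq_of_valuation_pow_sub_C_lt_one`: reduce `Y` modulo `t`) `s = Y(0)^p` in `F = 𝔽₂(s)`,
contradicting `Literature.Barriers.ResolutionOfSingularities.ratFuncX_ne_pow`.  Consequence for provers: the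
crux's hypothesis is never applicable to a positive-dimensional rank-one valuation ring of the SAME valued
function field under any admissible (perfect) change of ground field; the dimension half must pass through
an auxiliary valued function field over a perfect transcendental extension of `k` and descend regularity
along an inseparable extension of `K` (barrier `InseparableBaseChange`).  Companion (trivial-valuation
form): `Negative/NotPerfectRebase.lean`; full analysis: `Cruxes/ResidueTranscendenceReduction/Disproof.lean`.
-/

set_option linter.dupNamespace false -- mandated namespace of this single-conjunct summit

open scoped Polynomial IntermediateField
open IsDedekindDomain.HeightOneSpectrum

namespace Summit.ResolutionOfSingularities.ResolutionOfSingularities.Theorems.ResidueTranscendenceReduction.Negative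

/-! ## The residue-field mechanism (general valuation rings) -/

/-- If `x ∈ O` has residue ALGEBRAIC over the residue image of a PERFECT subfield `k' ⊆ O` (this is what
"`O` zero-dimensional over `k'`" says about `x`), then the residue of `x` is a `p`-th power: there is
`Y ∈ O` with `Y^p − x` in the maximal ideal.  (The residue image `L` of `k'` is perfect, `L(x̄)` is an
algebraic extension of a perfect field, hence perfect.) [folklore] -/
theorem exists_pow_sub_mem_nonunits_of_perfect {k K : Type} [Field k] [Field K] [Algebra k K]
    (p : ℕ) [hp : Fact p.Prime] [CharP K p] (O : ValuationSubring K) (k' : IntermediateField k K)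
    (hk' : ∀ c : k', (c : K) ∈ O) [PerfectField k'] {x : K} (hx : x ∈ O)
    (halg : ∃ f : Polynomial k', f ≠ 0 ∧ Polynomial.aeval x f ∈ O.nonunits) :
    ∃ Y ∈ O, Y ^ p - x ∈ O.nonunits := by
  classical
  obtain ⟨f, hf0, hf⟩ := halg
  -- the inclusion `k' → O` and its composite with the residue map
  let φ : k' →+* O := (algebraMap k' K).codRestrict O (fun c => hk' c)
  let κ := IsLocalRing.ResidueField O
  let ψ : k' →+* κ := (IsLocalRing.residue O).comp φ
  haveI : CharP k' p := ((algebraMap k' K).charP_iff_charP p).mpr inferInstance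
  haveI : CharP κ p := (ψ.charP_iff_charP p).mp inferInstance
  haveI : ExpChar k' p := ExpChar.prime hp.out
  haveI : ExpChar κ p := ExpChar.prime hp.out
  haveI : PerfectRing k' p := PerfectField.toPerfectRing p
  -- the residue image `L` of `k'` is perfect
  let L : Subfield κ := ψ.fieldRange
  haveI : CharP L p := ((algebraMap L κ).charP_iff_charP p).mpr inferInstance
  haveI : ExpChar L p := ExpChar.prime hp.out
  haveI : PerfectRing L p := by
    refine PerfectRing.ofSurjective L p fun y => ?_
    obtain ⟨c, hc⟩ := ψ.mem_fieldRange.mp y.2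
    obtain ⟨d, rfl⟩ := surjective_frobenius k' p c
    refine ⟨⟨ψ d, ψ.mem_fieldRange.mpr ⟨d, rfl⟩⟩, Subtype.ext ?_⟩
    simp [frobenius_def, ← hc]
  haveI : PerfectField L := PerfectRing.toPerfectField L p
  -- the residue `x̄` of `x` is a root of `f` pushed to the residue field
  let xO : O := ⟨x, hx⟩
  let xbar : κ := IsLocalRing.residue O xO
  have hcoe : ((Polynomial.eval₂ φ xO f : O) : K) = Polynomial.aeval x f := by
    rw [show ((Polynomial.eval₂ φ xO f : O) : K) = O.subtype (Polynomial.eval₂ φ xO f) from rfl,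
      Polynomial.hom_eval₂, Polynomial.aeval_def]
    rfl
  have hroot : Polynomial.eval₂ ψ xbar f = 0 := by
    have h1 : Polynomial.eval₂ ψ xbar f = IsLocalRing.residue O (Polynomial.eval₂ φ xO f) := by
      rw [Polynomial.hom_eval₂]
    rw [h1, IsLocalRing.residue_eq_zero_iff, ValuationSubring.valuation_lt_one_iff, hcoe,
      ← ValuationSubring.mem_nonunits_iff]
    exact hf
  have halgL : IsAlgebraic L xbar := by
    refine ⟨f.map ψ.rangeRestrictField, (Polynomial.map_ne_zero_iff ψ.rangeRestrictField.injective).mpr hf0,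
      ?_⟩
    rw [Polynomial.aeval_def, Polynomial.eval₂_map]
    exact hroot
  -- `L(x̄)` is perfect, so `x̄` is a `p`-th power in the residue field
  haveI : FiniteDimensional L L⟮xbar⟯ := IntermediateField.adjoin.finiteDimensional halgL.isIntegral
  haveI : Algebra.IsAlgebraic L L⟮xbar⟯ := Algebra.IsAlgebraic.of_finite L _
  haveI : PerfectField L⟮xbar⟯ := Algebra.IsAlgebraic.perfectField L
  haveI : CharP L⟮xbar⟯ p := ((algebraMap L⟮xbar⟯ κ).charP_iff_charP p).mpr inferInstance
  haveI : ExpChar L⟮xbar⟯ p := ExpChar.prime hp.out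
  haveI : PerfectRing L⟮xbar⟯ p := PerfectField.toPerfectRing p
  obtain ⟨z, hz⟩ := surjective_frobenius L⟮xbar⟯ p ⟨xbar, IntermediateField.mem_adjoin_simple_self L xbar⟩
  have hz' : ((z : κ)) ^ p = xbar := by
    have := congrArg (fun w : L⟮xbar⟯ => (w : κ)) hz
    simpa [frobenius_def] using this
  -- lift `z` to `O`
  obtain ⟨Y, hY⟩ := Ideal.Quotient.mk_surjective (I := IsLocalRing.maximalIdeal O) (z : κ)
  have hY' : IsLocalRing.residue O Y = (z : κ) := hY
  refine ⟨(Y : K), Y.2, ?_⟩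
  have hcoe2 : (Y : K) ^ p - x = ((Y ^ p - xO : O) : K) := by push_cast; rfl
  rw [ValuationSubring.mem_nonunits_iff, hcoe2, ← ValuationSubring.valuation_lt_one_iff,
    ← IsLocalRing.residue_eq_zero_iff, map_sub, map_pow, hY', hz']
  exact sub_self _

/-- **Zero-dimensional over a perfect subfield ⇒ perfect residue field.** If every element of a valuation
ring `O` has residue algebraic over the residue image of a PERFECT subfield `k' ⊆ O`, then the residue field
of `O` is perfect (it is an algebraic extension of the perfect field `k̄'`).  Contrapositive, for provers: a
valuation ring whose residue field is imperfect (e.g. finitely generated and transcendental over a perfect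
`k`, such as `𝔽_p(s)`) is zero-dimensional over NO perfect subfield. [folklore] -/
theorem perfectField_residueField_of_zeroDim_perfect {k K : Type} [Field k] [Field K] [Algebra k K]
    (p : ℕ) [hp : Fact p.Prime] [CharP K p] (O : ValuationSubring K) (k' : IntermediateField k K)
    (hk' : ∀ c : k', (c : K) ∈ O) [PerfectField k']
    (hzd : ∀ x ∈ O, ∃ f : Polynomial k', f ≠ 0 ∧ Polynomial.aeval x f ∈ O.nonunits) :
    PerfectField (IsLocalRing.ResidueField O) := by
  classical
  let φ : k' →+* O := (algebraMap k' K).codRestrict O (fun c => hk' c)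
  let κ := IsLocalRing.ResidueField O
  let ψ : k' →+* κ := (IsLocalRing.residue O).comp φ
  haveI : CharP k' p := ((algebraMap k' K).charP_iff_charP p).mpr inferInstance
  haveI : CharP κ p := (ψ.charP_iff_charP p).mp inferInstance
  haveI : ExpChar k' p := ExpChar.prime hp.out
  haveI : ExpChar κ p := ExpChar.prime hp.out
  haveI : PerfectRing k' p := PerfectField.toPerfectRing p
  let L : Subfield κ := ψ.fieldRange
  haveI : CharP L p := ((algebraMap L κ).charP_iff_charP p).mpr inferInstance
  haveI : ExpChar L p := ExpChar.prime hp.out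
  haveI : PerfectRing L p := by
    refine PerfectRing.ofSurjective L p fun y => ?_
    obtain ⟨c, hc⟩ := ψ.mem_fieldRange.mp y.2
    obtain ⟨d, rfl⟩ := surjective_frobenius k' p c
    refine ⟨⟨ψ d, ψ.mem_fieldRange.mpr ⟨d, rfl⟩⟩, Subtype.ext ?_⟩
    simp [frobenius_def, ← hc]
  haveI : PerfectField L := PerfectRing.toPerfectField L p
  haveI : Algebra.IsAlgebraic L κ := by
    refine ⟨fun xbar => ?_⟩
    obtain ⟨xO, rfl⟩ := Ideal.Quotient.mk_surjective (I := IsLocalRing.maximalIdeal O) xbar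
    obtain ⟨f, hf0, hf⟩ := hzd (xO : K) xO.2
    have hcoe : ((Polynomial.eval₂ φ xO f : O) : K) = Polynomial.aeval (xO : K) f := by
      rw [show ((Polynomial.eval₂ φ xO f : O) : K) = O.subtype (Polynomial.eval₂ φ xO f) from rfl,
        Polynomial.hom_eval₂, Polynomial.aeval_def]
      rfl
    have hroot : Polynomial.eval₂ ψ (IsLocalRing.residue O xO) f = 0 := by
      have h1 : Polynomial.eval₂ ψ (IsLocalRing.residue O xO) f =
          IsLocalRing.residue O (Polynomial.eval₂ φ xO f) := by
        rw [Polynomial.hom_eval₂]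
      rw [h1, IsLocalRing.residue_eq_zero_iff, ValuationSubring.valuation_lt_one_iff, hcoe,
        ← ValuationSubring.mem_nonunits_iff]
      exact hf
    refine ⟨f.map ψ.rangeRestrictField, (Polynomial.map_ne_zero_iff ψ.rangeRestrictField.injective).mpr hf0,
      ?_⟩
    rw [Polynomial.aeval_def, Polynomial.eval₂_map]
    exact hroot
  exact Algebra.IsAlgebraic.perfectField L

/-! ## The `t`-adic computation on `F(t)` -/

/-- If `Y ∈ F(t)` is `t`-integral and `Yⁿ ≡ a (mod t)` for a constant `a ∈ F`, then `a` is an `n`-th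
power in `F` (namely `a = Y(0)ⁿ`). [folklore] -/
theorem exists_pow_eq_of_valuation_pow_sub_C_lt_one {F : Type} [Field F] (Y : RatFunc F) (a : F) (n : ℕ)
    (hY : (Polynomial.idealX F).valuation (RatFunc F) Y ≤ 1)
    (h : (Polynomial.idealX F).valuation (RatFunc F) (Y ^ n - RatFunc.C a) < 1) :
    ∃ b : F, b ^ n = a := by
  have hd : Y.denom ≠ 0 := RatFunc.denom_ne_zero Y
  have hd' : algebraMap F[X] (RatFunc F) Y.denom ≠ 0 := RatFunc.algebraMap_ne_zero hd
  -- the denominator of a `t`-integral element is not divisible by `t`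
  have hd0 : Y.denom.coeff 0 ≠ 0 := by
    intro h0
    have hXd : Polynomial.X ∣ Y.denom := Polynomial.X_dvd_iff.mpr h0
    have hvd : (Polynomial.idealX F).intValuation Y.denom < 1 :=
      (intValuation_lt_one_iff_mem _ _).mpr
        (by rw [Polynomial.idealX_span]; exact Ideal.mem_span_singleton.mpr hXd)
    have hXn : ¬ Polynomial.X ∣ Y.num := by
      intro hXn
      obtain ⟨c, d, hcd⟩ := RatFunc.isCoprime_num_denom Y
      have : Polynomial.X ∣ (1 : F[X]) := hcd ▸ dvd_add (dvd_mul_of_dvd_right hXn c)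
        (dvd_mul_of_dvd_right hXd d)
      exact Polynomial.not_isUnit_X (isUnit_of_dvd_one this)
    have hvn : (Polynomial.idealX F).intValuation Y.num = 1 :=
      intValuation_eq_one_iff.mpr
        (by rw [Polynomial.idealX_span]; exact fun h => hXn (Ideal.mem_span_singleton.mp h))
    have hvx : (Polynomial.idealX F).valuation (RatFunc F) Y =
        1 / (Polynomial.idealX F).intValuation Y.denom := by
      conv_lhs => rw [← RatFunc.num_div_denom Y]
      rw [map_div₀, valuation_of_algebraMap, valuation_of_algebraMap, hvn]
    have hpos : 0 < (Polynomial.idealX F).intValuation Y.denom :=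
      zero_lt_iff.mpr (intValuation_ne_zero _ _ hd)
    have : 1 < (Polynomial.idealX F).valuation (RatFunc F) Y := by
      rw [hvx, one_div, one_lt_inv₀ hpos]; exact hvd
    exact absurd hY (not_le.mpr this)
  have hvd : (Polynomial.idealX F).intValuation Y.denom = 1 :=
    intValuation_eq_one_iff.mpr (by
      rw [Polynomial.idealX_span]
      exact fun h => hd0 (Polynomial.X_dvd_iff.mp (Ideal.mem_span_singleton.mp h)))
  -- `Yⁿ − a = N / denomⁿ` with `N = numⁿ − a·denomⁿ`
  set N : F[X] := Y.num ^ n - Polynomial.C a * Y.denom ^ n with hN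
  have hY' : Y ^ n - RatFunc.C a =
      algebraMap F[X] (RatFunc F) N / algebraMap F[X] (RatFunc F) (Y.denom ^ n) := by
    conv_lhs => rw [← RatFunc.num_div_denom Y]
    rw [hN, map_sub, map_mul, map_pow, map_pow, RatFunc.algebraMap_C, div_pow, sub_div, mul_div_assoc,
      div_self (pow_ne_zero _ hd'), mul_one]
  have hvN : (Polynomial.idealX F).intValuation N < 1 := by
    have h' := h
    rw [hY', map_div₀, valuation_of_algebraMap, valuation_of_algebraMap, map_pow, hvd, one_pow,
      div_one] at h'
    exact h'
  -- so `t ∣ N`, i.e. `N(0) = 0`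
  have hXN : Polynomial.X ∣ N := by
    rw [intValuation_lt_one_iff_mem, Polynomial.idealX_span] at hvN
    exact Ideal.mem_span_singleton.mp hvN
  have hN0 : N.coeff 0 = 0 := Polynomial.X_dvd_iff.mp hXN
  rw [hN, Polynomial.coeff_zero_eq_eval_zero] at hN0
  simp only [Polynomial.eval_sub, Polynomial.eval_mul, Polynomial.eval_pow, Polynomial.eval_C] at hN0
  refine ⟨Y.num.eval 0 / Y.denom.eval 0, ?_⟩
  have hd0' : Y.denom.eval 0 ≠ 0 := by rwa [← Polynomial.coeff_zero_eq_eval_zero]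
  rw [div_pow, div_eq_iff (pow_ne_zero _ hd0'), ← sub_eq_zero]
  exact hN0

/-! ## The witness `K = 𝔽_p(s)(t)`, `O` the `t`-adic ring -/

section Witness

variable (p : ℕ) [hp : Fact p.Prime]

/-- Constants of `𝔽_p` lie in the `t`-adic valuation ring of `𝔽_p(s)(t)`. [folklore] -/
theorem const_mem_tAdic (c : ZMod p) :
    algebraMap (ZMod p) (RatFunc (RatFunc (ZMod p))) c ∈
      ((Polynomial.idealX (RatFunc (ZMod p))).valuation (RatFunc (RatFunc (ZMod p)))).valuationSubring := by
  rw [Valuation.mem_valuationSubring_iff,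
    IsScalarTower.algebraMap_apply (ZMod p) (RatFunc (ZMod p))[X] (RatFunc (RatFunc (ZMod p)))]
  exact valuation_le_one _ _

/-- `s = C X` lies in the `t`-adic valuation ring (it is a unit). [folklore] -/
theorem C_X_mem_tAdic :
    (RatFunc.C RatFunc.X : RatFunc (RatFunc (ZMod p))) ∈
      ((Polynomial.idealX (RatFunc (ZMod p))).valuation (RatFunc (RatFunc (ZMod p)))).valuationSubring := by
  rw [Valuation.mem_valuationSubring_iff, ← RatFunc.algebraMap_C]
  exact valuation_le_one _ _

/-- `𝔽_p(s)(t)` is finitely generated over `𝔽_p`. [folklore] -/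
theorem fg_top_ratFunc_ratFunc :
    (⊤ : IntermediateField (ZMod p) (RatFunc (RatFunc (ZMod p)))).FG := by
  haveI : IsScalarTower (ZMod p) (RatFunc (ZMod p)) (RatFunc (RatFunc (ZMod p))) :=
    IsScalarTower.of_algebraMap_eq fun c => by
      rw [IsScalarTower.algebraMap_apply (ZMod p) (RatFunc (ZMod p))[X] (RatFunc (RatFunc (ZMod p))),
        Polynomial.algebraMap_apply, RatFunc.algebraMap_C, RatFunc.algebraMap_eq_C, RatFunc.algebraMap_eq_C]
  haveI h1 : Algebra.EssFiniteType (ZMod p) (RatFunc (ZMod p)) :=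
    IntermediateField.fg_top_iff.mp ⟨{RatFunc.X}, by simp [RatFunc.adjoin_X]⟩
  haveI h2 : Algebra.EssFiniteType (RatFunc (ZMod p)) (RatFunc (RatFunc (ZMod p))) :=
    IntermediateField.fg_top_iff.mp ⟨{RatFunc.X}, by simp [RatFunc.adjoin_X]⟩
  haveI : Algebra.EssFiniteType (ZMod p) (RatFunc (RatFunc (ZMod p))) :=
    Algebra.EssFiniteType.comp (ZMod p) (RatFunc (ZMod p)) (RatFunc (RatFunc (ZMod p)))
  exact IntermediateField.fg_top _ _

/-- The `t`-adic valuation ring of `𝔽_p(s)(t)` is rank one. [folklore] -/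
theorem rankOne_tAdic :
    Nonempty ((Polynomial.idealX (RatFunc (ZMod p))).valuation
      (RatFunc (RatFunc (ZMod p)))).valuationSubring.valuation.RankOne := by
  set vX := (Polynomial.idealX (RatFunc (ZMod p))).valuation (RatFunc (RatFunc (ZMod p))) with hvX
  have isEquiv_OX : vX.IsEquiv vX.valuationSubring.valuation :=
    Valuation.isEquiv_valuation_valuationSubring _
  haveI : vX.valuationSubring.valuation.IsNontrivial := by
    refine ⟨RatFunc.X, ?_, ?_⟩
    · simp [RatFunc.X_ne_zero]
    · intro h1
      have := (isEquiv_OX.symm.eq_one_iff_eq_one).mp h1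
      rw [hvX, Polynomial.valuation_X_eq_neg_one] at this
      simp at this
  rw [Valuation.nonempty_rankOne_iff_mulArchimedean]
  haveI h1 : MulArchimedean (MonoidWithZeroHom.ValueGroup₀ (.ofClass vX)) :=
    MulArchimedean.comap MonoidWithZeroHom.ValueGroup₀.embedding.toMonoidHom
      MonoidWithZeroHom.ValueGroup₀.embedding_strictMono
  exact MulArchimedean.comap (isEquiv_OX.symm.orderMonoidIso).toMonoidHom
    (isEquiv_OX.symm.orderMonoidIso).strictMono

/-- At the `t`-adic place of `𝔽_p(s)(t)`, no perfect subfield of the valuation ring has `s̄` algebraic over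
its residue image. [folklore] -/
theorem not_exists_perfect_zeroDim_tAdic :
    ¬ ∃ k' : IntermediateField (ZMod p) (RatFunc (RatFunc (ZMod p))),
        (∀ c : k', (c : RatFunc (RatFunc (ZMod p))) ∈
          ((Polynomial.idealX (RatFunc (ZMod p))).valuation (RatFunc (RatFunc (ZMod p)))).valuationSubring) ∧
        PerfectField k' ∧
        ∀ x ∈ ((Polynomial.idealX (RatFunc (ZMod p))).valuation (RatFunc (RatFunc (ZMod p)))).valuationSubring,
          ∃ f : Polynomial k', f ≠ 0 ∧ Polynomial.aeval x f ∈
            ((Polynomial.idealX (RatFunc (ZMod p))).valuation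
              (RatFunc (RatFunc (ZMod p)))).valuationSubring.nonunits := by
  rintro ⟨k', hk', hperf, hzd⟩
  set vX := (Polynomial.idealX (RatFunc (ZMod p))).valuation (RatFunc (RatFunc (ZMod p))) with hvX
  haveI := hperf
  haveI : CharP (RatFunc (RatFunc (ZMod p))) p :=
    charP_of_injective_algebraMap (algebraMap (ZMod p) (RatFunc (RatFunc (ZMod p)))).injective p
  obtain ⟨Y, hYO, hY⟩ := exists_pow_sub_mem_nonunits_of_perfect p vX.valuationSubring k' hk'
    (C_X_mem_tAdic p) (hzd _ (C_X_mem_tAdic p))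
  rw [ValuationSubring.mem_nonunits_iff,
    ← (Valuation.isEquiv_valuation_valuationSubring vX).lt_one_iff_lt_one] at hY
  rw [Valuation.mem_valuationSubring_iff] at hYO
  obtain ⟨b, hb⟩ := exists_pow_eq_of_valuation_pow_sub_C_lt_one Y RatFunc.X p hYO hY
  exact Literature.Barriers.ResolutionOfSingularities.ratFuncX_ne_pow p b hb

/-- **A rank-one instance of the conclusion outside the hypothesis.** The `t`-adic valuation ring of
`𝔽_p(s)(t)` lies in the range of the crux's conclusion (`k = 𝔽_p` perfect, `K` finitely generated,
`k ⊆ O`), IS rank one, and is NOT zero-dimensional over `k` (take `k' = ⊥ ≅ 𝔽_p`, a perfect field, in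
`not_exists_perfect_zeroDim_tAdic`): a typed instance of the open DIMENSION HALF of the crux (rank one,
residue field `𝔽_p(s)` transcendental over `k`), complementing the trivial-valuation range lemma of
`Negative/ConclusionRangeExceedsHypothesis.lean`. [folklore] -/
theorem exists_rankOne_conclusion_instance_not_zeroDim :
    ∃ (K : Type) (_ : Field K) (_ : Algebra (ZMod p) K) (O : ValuationSubring K),
      (⊤ : IntermediateField (ZMod p) K).FG ∧ (∀ c : ZMod p, algebraMap (ZMod p) K c ∈ O) ∧
        Nonempty O.valuation.RankOne ∧
        ¬ (∀ x ∈ O, ∃ f : Polynomial (ZMod p), f ≠ 0 ∧ Polynomial.aeval x f ∈ O.nonunits) := by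
  refine ⟨RatFunc (RatFunc (ZMod p)), inferInstance, inferInstance, _, fg_top_ratFunc_ratFunc p,
    const_mem_tAdic p, rankOne_tAdic p, fun hzd => ?_⟩
  refine not_exists_perfect_zeroDim_tAdic p ⟨⊥, fun c => ?_, ?_, fun x hx => ?_⟩
  · obtain ⟨a, ha⟩ := IntermediateField.mem_bot.mp c.2
    rw [← ha]
    exact const_mem_tAdic p a
  · haveI : Finite (⊥ : IntermediateField (ZMod p) (RatFunc (RatFunc (ZMod p)))) :=
      Finite.of_equiv (ZMod p) (IntermediateField.botEquiv (ZMod p) (RatFunc (RatFunc (ZMod p)))).symm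
    exact PerfectField.ofFinite
  · obtain ⟨f, hf0, hf⟩ := hzd x hx
    refine ⟨f.map (algebraMap (ZMod p) (⊥ : IntermediateField (ZMod p) (RatFunc (RatFunc (ZMod p))))),
      (Polynomial.map_ne_zero_iff (algebraMap (ZMod p) _).injective).mpr hf0, ?_⟩
    rwa [Polynomial.aeval_map_algebraMap]

end Witness

/-- **No perfect rebasing at rank-one places.** It is NOT the case that every RANK-ONE valuation ring
`O ⊇ k` of a finitely generated extension `K` of a perfect field `k` of characteristic `p` admits a perfect
intermediate ground field `k ⊆ k' ⊆ O` over which `O` is zero-dimensional.  Witness `p = 2`, `k = 𝔽₂`,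
`K = 𝔽₂(s)(t)`, `O` the `t`-adic valuation ring (discrete, rank one, residue field `𝔽₂(s)`).  Hence the
hypothesis of `ResidueTranscendenceReduction` (rank-one zero-dimensional valuation rings over PERFECT
fields) can never be applied to a positive-dimensional rank-one valuation ring of the same valued function
field after a change of ground field — Zariski's device C.IV §9 is unavailable inside the crux's frame.
[folklore] -/
theorem not_perfectRebase_rankOne :
    ¬ (∀ p : ℕ, p.Prime → ∀ (k K : Type) [Field k] [CharP k p] [PerfectField k] [Field K] [Algebra k K],
        (⊤ : IntermediateField k K).FG → ∀ O : ValuationSubring K, (∀ c : k, algebraMap k K c ∈ O) →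
          Nonempty O.valuation.RankOne →
          ∃ k' : IntermediateField k K, (∀ c : k', (c : K) ∈ O) ∧ PerfectField k' ∧
            ∀ x ∈ O, ∃ f : Polynomial k', f ≠ 0 ∧ Polynomial.aeval x f ∈ O.nonunits) := by
  intro h
  haveI : Fact (Nat.Prime 2) := ⟨Nat.prime_two⟩
  haveI : PerfectField (ZMod 2) := PerfectField.ofFinite
  exact not_exists_perfect_zeroDim_tAdic 2 (h 2 Nat.prime_two (ZMod 2) (RatFunc (RatFunc (ZMod 2)))
    (fg_top_ratFunc_ratFunc 2) _ (const_mem_tAdic 2) (rankOne_tAdic 2))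

end Summit.ResolutionOfSingularities.ResolutionOfSingularities.Theorems.ResidueTranscendenceReduction.Negative
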